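import Mathlib
import Summits.MatrixMultiplication.MatrixMultiplication.Theses.GLnSeparatingDesigns
import Literature.Computability.AlgebraicComplexity.MatrixMultiplicationExponent
import Literature.Computability.AlgebraicComplexity.FlatteningBound

/-!
# `GLnSeparatingDesigns.SeparationDegreeCost` (stmt-MatrixMultiplication-18361) — Negative lane I:
# the limit `η → 0` is load-bearing (no fixed tolerance prices designs)

Negative / support lemmas of the standing disprover (`Cruxes/SeparationDegreeCost/Disproof.lean`),
landed for import by ideators, planners and the line lead.  No Theses statement is asserted
positively here.  The crux (BCGPU 2024 Cor. 2.8, border clause) says: for `n ≥ 3`, `s ≥ 2`, if FOR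
EVERY `η > 0` there are TPP subsets `X, Y, Z ⊆ GL_n(ℂ)` of sizes `≥ N₁, N₂, N₃` carrying `η`-approximate
separating polynomials of total degree `≤ s`, then
`(N₁N₂N₃)^{ω/3} ≤ s^{(n(n−1)/2)(ω−2)} · C(s+n², n²)`.

* `separationDegreeCost_iff` — the crux is literally
  `∀ n ≥ 3, ∀ s ≥ 2, ∀ N, (∀ η > 0, DesignAt n s N η) → Conclusion n s N`;
  `designAt_of_points` — `X`-only designs (`Y = Z = {1}`: TPP automatic, a separator for `x₀` is a
  polynomial `≈ 1` at `x₀` and `≈ 0` on `X ∖ {x₀}`); `toGL` — integer `3 × 3` matrices in `GL₃(ℂ)`.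
* `separationDegreeCost_fixedTol_false` — **the limit `η → 0` is load-bearing**: the variant asking
  for a design at ONE tolerance `η` (a strengthening of the crux, `separationDegreeCost_of_fixedTol`)
  is FALSE for every `η ≥ 3/7`.  Witness (`n = 3`, `s = 2`, `Y = Z = {1}`): `X` = the `576`
  invertible `3 × 3` matrices with entries in `{0, ±1}` and exactly four non-zero entries
  (`design576 : Param → _`, `3·2·3·2·2⁴` parameters `(σ = (r ↦ t ∓ r), i, τ, signs)`, injective by a
  `decide`d left inverse); for `x₀ ∈ X` the quadratic `((2ℓ + 1)² − 25)/56`, `ℓ(g) = Σ_{ij} (x₀)_{ij} g_{ij}`,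
  is `1` at `x₀` and has modulus `≤ 3/7` on `X ∖ {x₀}` (Frobenius products of distinct norm-`4` integer
  matrices lie in `[-4, 3]`); but `576 > 512 = 8³` gives `576^{ω/3} > 8^ω = 64·8^{ω−2} > 55·8^{ω−2}` =
  the right-hand side, for ANY value of `ω > 0` — no bound on `ω` is used.
  Conjecturally the fixed-tolerance variant fails for every `η > 0` (spherical codes in `ℝ^{n²}`,
  `p = T_s(⟨g, x₀⟩)`, `s ≈ n²`); only `η ≥ 3/7` is proved here.  For the prover: the price is a genuine
  BORDER statement — an `η`-approximate restriction at one fixed `η < 1/2` carries no `ω`-information,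
  only the family `η → 0` (degeneration of `⊕_λ ⟨d_λ⟩`) does.
-/
-- `Summit.<S>.<S>.…` repeats `MatrixMultiplication` (summit = sub-problem) by design (lakefile: linter off).
set_option linter.dupNamespace false

namespace Summit.MatrixMultiplication.MatrixMultiplication.Theorems

open scoped BigOperators
open Literature.Computability.AlgebraicComplexity
open Summit.MatrixMultiplication.MatrixMultiplication.Theses.GLnSeparatingDesigns (SeparationDegreeCost)

namespace SeparationDegreeCostNeg

/-! ## The crux, sliced by tolerance -/

/-- The design clause of the crux at ONE tolerance `η` (verbatim body of its hypothesis). [folklore] -/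
def DesignAt (n s N₁ N₂ N₃ : ℕ) (η : ℝ) : Prop :=
  ∃ X Y Z : Finset (Matrix.GeneralLinearGroup (Fin n) ℂ), N₁ ≤ X.card ∧ N₂ ≤ Y.card ∧ N₃ ≤ Z.card ∧ (∀ x ∈ X, ∀ x' ∈ X, ∀ y ∈ Y, ∀ y' ∈ Y, ∀ z ∈ Z, ∀ z' ∈ Z, x * y⁻¹ * y' * z⁻¹ = x' * z'⁻¹ → x = x' ∧ y = y' ∧ z = z') ∧ ∀ x₀ ∈ X, ∀ z₀ ∈ Z, ∃ p : MvPolynomial (Fin n × Fin n) ℂ, p.totalDegree ≤ s ∧ ∀ x ∈ X, ∀ y ∈ Y, ∀ y' ∈ Y, ∀ z ∈ Z, ((x = x₀ ∧ y = y' ∧ z = z₀) → ‖MvPolynomial.eval (fun ij : Fin n × Fin n => ((x * y⁻¹ * y' * z⁻¹ : Matrix.GeneralLinearGroup (Fin n) ℂ) : Matrix (Fin n) (Fin n) ℂ) ij.1 ij.2) p - 1‖ ≤ η) ∧ (¬ (x = x₀ ∧ y = y' ∧ z = z₀) → ‖MvPolynomial.eval (fun ij : Fin n × Fin n => ((x *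 y⁻¹ * y' * z⁻¹ : Matrix.GeneralLinearGroup (Fin n) ℂ) : Matrix (Fin n) (Fin n) ℂ) ij.1 ij.2) p‖ ≤ η)

/-- The conclusion of the crux. [folklore] -/
def Conclusion (n s N₁ N₂ N₃ : ℕ) : Prop :=
  ((N₁ : ℝ) * N₂ * N₃) ^ (omega ℂ / 3) ≤
    (s : ℝ) ^ ((n : ℝ) * (n - 1) / 2 * (omega ℂ - 2)) * ((s + n ^ 2).choose (n ^ 2) : ℝ)

/-- The crux is literally `∀ n ≥ 3, ∀ s ≥ 2, ∀ N, (∀ η > 0, DesignAt …) → Conclusion …`. [folklore] -/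
theorem separationDegreeCost_iff :
    SeparationDegreeCost ↔ ∀ n : ℕ, 3 ≤ n → ∀ s : ℕ, 2 ≤ s → ∀ N₁ N₂ N₃ : ℕ,
      (∀ η : ℝ, 0 < η → DesignAt n s N₁ N₂ N₃ η) → Conclusion n s N₁ N₂ N₃ :=
  Iff.rfl

/-- `X`-only designs: with `Y = Z = {1}` the TPP is automatic and a separator for the target `x₀`
is a polynomial that is `≈ 1` at `x₀` and `≈ 0` on `X ∖ {x₀}`. [folklore] -/
theorem designAt_of_points {n s : ℕ} {η : ℝ} (X : Finset (Matrix.GeneralLinearGroup (Fin n) ℂ))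
    (hsep : ∀ x₀ ∈ X, ∃ p : MvPolynomial (Fin n × Fin n) ℂ, p.totalDegree ≤ s ∧ ∀ x ∈ X,
      (x = x₀ → ‖MvPolynomial.eval (fun ij : Fin n × Fin n =>
        ((x : Matrix.GeneralLinearGroup (Fin n) ℂ) : Matrix (Fin n) (Fin n) ℂ) ij.1 ij.2) p - 1‖ ≤ η) ∧
      (x ≠ x₀ → ‖MvPolynomial.eval (fun ij : Fin n × Fin n =>
        ((x : Matrix.GeneralLinearGroup (Fin n) ℂ) : Matrix (Fin n) (Fin n) ℂ) ij.1 ij.2) p‖ ≤ η)) :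
    DesignAt n s X.card 1 1 η := by
  refine ⟨X, {1}, {1}, le_rfl, by simp, by simp, ?_, ?_⟩
  · intro x _ x' _ y hy y' hy' z hz z' hz' h
    simp only [Finset.mem_singleton] at hy hy' hz hz'
    subst hy hy' hz hz'
    simpa using h
  · intro x₀ hx₀ z₀ hz₀
    simp only [Finset.mem_singleton] at hz₀
    subst hz₀
    obtain ⟨p, hp, hsep⟩ := hsep x₀ hx₀
    refine ⟨p, hp, ?_⟩
    intro x hx y hy y' hy' z hz
    simp only [Finset.mem_singleton] at hy hy' hz
    subst hy hy' hz
    simp only [inv_one, mul_one, and_true]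
    exact hsep x hx

/-- The trivial design `X = Y = Z = {1}`, `p = 1`, at every `s` and every `η ≥ 0`. [folklore] -/
theorem designAt_one (n s : ℕ) {η : ℝ} (hη : 0 ≤ η) : DesignAt n s 1 1 1 η := by
  have h := designAt_of_points (n := n) (s := s) (η := η) {1} (fun x₀ hx₀ => ⟨1, by simp, ?_⟩)
  · simpa using h
  · intro x hx
    simp only [Finset.mem_singleton] at hx hx₀
    subst hx hx₀
    exact ⟨fun _ => by simp [hη], fun h => (h rfl).elim⟩

/-! ## Integer `3 × 3` matrices as elements of `GL₃(ℂ)` -/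

/-- Explicit `3 × 3` determinant (computable, for `decide`). [folklore] -/
def det3 (M : Fin 3 → Fin 3 → ℤ) : ℤ :=
  M 0 0 * (M 1 1 * M 2 2 - M 1 2 * M 2 1) - M 0 1 * (M 1 0 * M 2 2 - M 1 2 * M 2 0)
    + M 0 2 * (M 1 0 * M 2 1 - M 1 1 * M 2 0)

/-- An integer matrix viewed over `ℂ`. [folklore] -/
def castM (A : Fin 3 → Fin 3 → ℤ) : Matrix (Fin 3) (Fin 3) ℂ := Matrix.of fun i j => (A i j : ℂ)

/-- The determinant commutes with the cast `ℤ → ℂ` (via the explicit `3 × 3` formula). [folklore] -/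
theorem det_castM (A : Fin 3 → Fin 3 → ℤ) : (castM A).det = (det3 A : ℂ) := by
  simp only [Matrix.det_fin_three, castM, Matrix.of_apply, det3]
  push_cast
  ring

/-- Total map to `GL₃(ℂ)` (junk value `1` on singular matrices). [folklore] -/
noncomputable def toGL (A : Fin 3 → Fin 3 → ℤ) : Matrix.GeneralLinearGroup (Fin 3) ℂ :=
  if h : det3 A = 0 then 1 else
    Matrix.GeneralLinearGroup.mkOfDetNeZero (castM A) (by rw [det_castM]; exact_mod_cast h)

/-- On invertible input `toGL A` is the matrix `A` itself. [folklore] -/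
theorem val_toGL {A : Fin 3 → Fin 3 → ℤ} (h : det3 A ≠ 0) :
    ((toGL A : Matrix.GeneralLinearGroup (Fin 3) ℂ) : Matrix (Fin 3) (Fin 3) ℂ) = castM A := by
  simp only [toGL, dif_neg h, Matrix.GeneralLinearGroup.val_mkOfDetNeZero]

/-- `toGL` is injective on invertible integer matrices. [folklore] -/
theorem toGL_inj {A B : Fin 3 → Fin 3 → ℤ} (hA : det3 A ≠ 0) (hB : det3 B ≠ 0)
    (h : toGL A = toGL B) : A = B := by
  have h' := congrArg (fun g : Matrix.GeneralLinearGroup (Fin 3) ℂ => (g : Matrix (Fin 3) (Fin 3) ℂ)) h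
  simp only [val_toGL hA, val_toGL hB] at h'
  funext i j
  have hij := congrFun (congrFun h' i) j
  simpa [castM] using hij

/-- Frobenius product and squared norm over `ℤ`. [folklore] -/
def ip (A B : Fin 3 → Fin 3 → ℤ) : ℤ := ∑ i, ∑ j, A i j * B i j

/-- The linear form `g ↦ ⟨A, g⟩` as a polynomial in the nine entries. [folklore] -/
noncomputable def lin (A : Fin 3 → Fin 3 → ℤ) : MvPolynomial (Fin 3 × Fin 3) ℂ :=
  ∑ i, ∑ j, MvPolynomial.C (A i j : ℂ) * MvPolynomial.X (i, j)

/-- The linear form has total degree `≤ 1`. [folklore] -/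
theorem totalDegree_lin (A : Fin 3 → Fin 3 → ℤ) : (lin A).totalDegree ≤ 1 := by
  unfold lin
  refine (MvPolynomial.totalDegree_finsetSum _ _).trans (Finset.sup_le fun i _ => ?_)
  refine (MvPolynomial.totalDegree_finsetSum _ _).trans (Finset.sup_le fun j _ => ?_)
  refine (MvPolynomial.totalDegree_mul _ _).trans ?_
  rw [MvPolynomial.totalDegree_C, MvPolynomial.totalDegree_X, zero_add]

/-- Evaluating the linear form of `A` at the integer point `B` gives `⟨A, B⟩`. [folklore] -/
theorem eval_lin (A B : Fin 3 → Fin 3 → ℤ) :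
    MvPolynomial.eval (fun ij : Fin 3 × Fin 3 => castM B ij.1 ij.2) (lin A) = (ip A B : ℂ) := by
  simp [lin, ip, castM, map_sum, MvPolynomial.eval_X]

/-! ## Fixed tolerance: the 576-point design -/

/-- Parameters `((t, m, i, b), (ε₀, ε₁, ε₂, e))` of the design: the permutation `σ : r ↦ t ∓ r` of
`Fin 3`, the row `i` carrying the fourth entry, which of the two free columns of row `i` it occupies,
and the four signs; `3·2·3·2·2⁴ = 576`.  (Grouped as a pair of quadruples: instance synthesis for
longer flat products fails.) [folklore] -/
abbrev Param := (Fin 3 × Bool × Fin 3 × Bool) × (Bool × Bool × Bool × Bool)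

/-- `±1` from a Boolean. [folklore] -/
def sgnZ (x : Bool) : ℤ := if x then 1 else -1

/-- The six permutations of `Fin 3`: `r ↦ t - r` (`m = true`) or `r ↦ t + r`. [folklore] -/
def perm3 (t : Fin 3) (m : Bool) (r : Fin 3) : Fin 3 := if m then t - r else t + r

/-- Sign selector for the three rows. [folklore] -/
def sel (ε₀ ε₁ ε₂ : Bool) (r : Fin 3) : Bool := if r = 0 then ε₀ else if r = 1 then ε₁ else ε₂

/-- The design matrix `Σ_r ±E_{r, σ r} ± E_{i, τ}` with `τ = σ i + 1` (`b = true`) or `σ i + 2`: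
entries in `{0, ±1}`, exactly four of them non-zero, determinant `±1`. [folklore] -/
def design576 (p : Param) : Fin 3 → Fin 3 → ℤ :=
  match p with
  | ((t, m, i, b), (ε₀, ε₁, ε₂, e)) => fun r c =>
    (if c = perm3 t m r then sgnZ (sel ε₀ ε₁ ε₂ r) else 0) +
      (if r = i ∧ c = perm3 t m r + (if b then 1 else 2) then sgnZ e else 0)

/-- First non-zero column of row `r`. [folklore] -/
def colOf (A : Fin 3 → Fin 3 → ℤ) (r : Fin 3) : Fin 3 :=
  if A r 0 ≠ 0 then 0 else if A r 1 ≠ 0 then 1 else 2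

/-- Number of non-zero entries of row `r`. [folklore] -/
def nzCount (A : Fin 3 → Fin 3 → ℤ) (r : Fin 3) : ℕ :=
  (if A r 0 ≠ 0 then 1 else 0) + (if A r 1 ≠ 0 then 1 else 0) + (if A r 2 ≠ 0 then 1 else 0)

/-- The row with two non-zero entries. [folklore] -/
def twoRow (A : Fin 3 → Fin 3 → ℤ) : Fin 3 :=
  if nzCount A 0 = 2 then 0 else if nzCount A 1 = 2 then 1 else 2

/-- The permutation `σ` read off a design matrix. [folklore] -/
def permOf (A : Fin 3 → Fin 3 → ℤ) (r : Fin 3) : Fin 3 :=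
  if r = twoRow A then -(colOf A (twoRow A + 1) + colOf A (twoRow A + 2)) else colOf A r

/-- The extra column `τ` read off a design matrix. [folklore] -/
def otherCol (A : Fin 3 → Fin 3 → ℤ) : Fin 3 :=
  if (0 : Fin 3) ≠ permOf A (twoRow A) ∧ A (twoRow A) 0 ≠ 0 then 0
  else if (1 : Fin 3) ≠ permOf A (twoRow A) ∧ A (twoRow A) 1 ≠ 0 then 1 else 2

/-- Left inverse of `design576` (so that injectivity is a `decide` over the 576 parameters). [folklore] -/
def param576 (A : Fin 3 → Fin 3 → ℤ) : Param :=
  ((permOf A 0, decide (permOf A 1 = permOf A 0 - 1), twoRow A,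
      decide (otherCol A = permOf A (twoRow A) + 1)),
    (decide (A 0 (permOf A 0) = 1), decide (A 1 (permOf A 1) = 1), decide (A 2 (permOf A 2) = 1),
      decide (A (twoRow A) (otherCol A) = 1)))

set_option maxRecDepth 16384 in
/-- `param576` is a left inverse of `design576` (checked on all 576 parameters). [folklore] -/
theorem param576_design576 : ∀ p : Param, param576 (design576 p) = p := by decide

/-- The 576 design matrices are pairwise distinct. [folklore] -/
theorem design576_injective : Function.Injective design576 := fun p q h => by
  have h' := congrArg param576 h
  rwa [param576_design576, param576_design576] at h'

set_option maxRecDepth 16384 in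
/-- Every design matrix has Frobenius norm `4` and non-zero determinant. [folklore] -/
theorem design576_good :
    ∀ p : Param, ip (design576 p) (design576 p) = 4 ∧ det3 (design576 p) ≠ 0 := by
  decide

/-- There are `576 > 512 = 8³` parameters. [folklore] -/
theorem card_param576 : Fintype.card Param = 576 := by simp

/-- `Σ (A − B)² ≥ 1` for distinct integer matrices: `2⟨A,B⟩ + 1 ≤ |A|² + |B|²`. [folklore] -/
theorem two_ip_succ_le {A B : Fin 3 → Fin 3 → ℤ} (hne : A ≠ B) : 2 * ip A B + 1 ≤ ip A A + ip B B := by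
  have hdif : ∑ i, ∑ j, (A i j - B i j) ^ 2 = ip A A + ip B B - 2 * ip A B := by
    simp only [ip, Finset.mul_sum, ← Finset.sum_add_distrib, ← Finset.sum_sub_distrib]
    refine Finset.sum_congr rfl fun i _ => Finset.sum_congr rfl fun j _ => by ring
  obtain ⟨i, hi⟩ := Function.ne_iff.1 hne
  obtain ⟨j, hj⟩ := Function.ne_iff.1 hi
  have hd : A i j - B i j ≠ 0 := sub_ne_zero.2 hj
  have h1 : 1 ≤ (A i j - B i j) ^ 2 := by
    have habs := Int.one_le_abs hd
    nlinarith [sq_abs (A i j - B i j), abs_nonneg (A i j - B i j)]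
  have h2 : (A i j - B i j) ^ 2 ≤ ∑ j', (A i j' - B i j') ^ 2 :=
    Finset.single_le_sum (f := fun j' => (A i j' - B i j') ^ 2) (fun _ _ => sq_nonneg _)
      (Finset.mem_univ j)
  have h3 : ∑ j', (A i j' - B i j') ^ 2 ≤ ∑ i', ∑ j', (A i' j' - B i' j') ^ 2 :=
    Finset.single_le_sum (f := fun i' => ∑ j', (A i' j' - B i' j') ^ 2)
      (fun _ _ => Finset.sum_nonneg fun _ _ => sq_nonneg _) (Finset.mem_univ i)
  omega

/-- `Σ (A + B)² ≥ 0`: `-(|A|² + |B|²) ≤ 2⟨A,B⟩`. [folklore] -/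
theorem neg_le_two_ip (A B : Fin 3 → Fin 3 → ℤ) : -(ip A A + ip B B) ≤ 2 * ip A B := by
  have hsum : ∑ i, ∑ j, (A i j + B i j) ^ 2 = ip A A + ip B B + 2 * ip A B := by
    simp only [ip, Finset.mul_sum, ← Finset.sum_add_distrib]
    refine Finset.sum_congr rfl fun i _ => Finset.sum_congr rfl fun j _ => by ring
  have hpos : 0 ≤ ∑ i, ∑ j, (A i j + B i j) ^ 2 :=
    Finset.sum_nonneg fun i _ => Finset.sum_nonneg fun j _ => sq_nonneg _
  omega

/-- Distinct integer matrices of norm `4` have Frobenius product in `[-4, 3]`. [folklore] -/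
theorem ip_bounds {A B : Fin 3 → Fin 3 → ℤ} (hA : ip A A = 4) (hB : ip B B = 4) (hne : A ≠ B) :
    -4 ≤ ip A B ∧ ip A B ≤ 3 := by
  have h1 := two_ip_succ_le hne
  have h2 := neg_le_two_ip A B
  constructor <;> omega

/-- The separator of the target `A`: `((2⟨A,g⟩ + 1)² − 25)/56`. [folklore] -/
noncomputable def sepPoly (A : Fin 3 → Fin 3 → ℤ) : MvPolynomial (Fin 3 × Fin 3) ℂ :=
  MvPolynomial.C (1 / 56 : ℂ) *
    ((MvPolynomial.C 2 * lin A + MvPolynomial.C 1) ^ 2 - MvPolynomial.C 25)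

/-- The separator is a quadratic polynomial in the nine entries. [folklore] -/
theorem totalDegree_sepPoly (A : Fin 3 → Fin 3 → ℤ) : (sepPoly A).totalDegree ≤ 2 := by
  unfold sepPoly
  refine (MvPolynomial.totalDegree_mul _ _).trans ?_
  rw [MvPolynomial.totalDegree_C, zero_add]
  refine (MvPolynomial.totalDegree_sub _ _).trans (max_le ?_ (by rw [MvPolynomial.totalDegree_C]; omega))
  refine (MvPolynomial.totalDegree_pow _ _).trans ?_
  have h1 : (MvPolynomial.C 2 * lin A + MvPolynomial.C 1).totalDegree ≤ 1 := by
    refine (MvPolynomial.totalDegree_add _ _).trans (max_le ?_ (by rw [MvPolynomial.totalDegree_C]; omega))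
    refine (MvPolynomial.totalDegree_mul _ _).trans ?_
    rw [MvPolynomial.totalDegree_C, zero_add]
    exact totalDegree_lin A
  omega

/-- The value of the separator at an integer point, as a real number. [folklore] -/
noncomputable def sepVal (k : ℤ) : ℝ := ((2 * k + 1) ^ 2 - 25) / 56

/-- Value of the separator of `A` at the integer point `B`: `sepVal ⟨A, B⟩`. [folklore] -/
theorem eval_sepPoly (A B : Fin 3 → Fin 3 → ℤ) :
    MvPolynomial.eval (fun ij : Fin 3 × Fin 3 => castM B ij.1 ij.2) (sepPoly A) =
      ((sepVal (ip A B) : ℝ) : ℂ) := by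
  simp only [sepPoly, map_mul, map_sub, map_pow, map_add, MvPolynomial.eval_C, eval_lin, sepVal]
  push_cast
  ring

/-- At the target (`⟨A, A⟩ = 4`) the separator is exactly `1`. [folklore] -/
theorem sepVal_four : sepVal 4 = 1 := by norm_num [sepVal]

/-- Off target (`⟨A, B⟩ ∈ [-4, 3]`) the separator has modulus `≤ 3/7`. [folklore] -/
theorem abs_sepVal_le {k : ℤ} (h1 : -4 ≤ k) (h2 : k ≤ 3) : |sepVal k| ≤ 3 / 7 := by
  unfold sepVal
  interval_cases k <;> norm_num [abs_le]

/-- **Fixed tolerance `≥ 3/7`: the 576-point design.** [folklore] -/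
theorem designAt_576 {η : ℝ} (hη : 3 / 7 ≤ η) : DesignAt 3 2 576 1 1 η := by
  classical
  set X : Finset (Matrix.GeneralLinearGroup (Fin 3) ℂ) :=
    (Finset.univ : Finset Param).image fun p => toGL (design576 p) with hX
  have hinj : Function.Injective fun p : Param => toGL (design576 p) := fun p q h =>
    design576_injective (toGL_inj (design576_good p).2 (design576_good q).2 h)
  have hcard : X.card = 576 := by
    rw [hX, Finset.card_image_of_injective _ hinj, Finset.card_univ, card_param576]
  rw [← hcard]
  refine designAt_of_points X fun x₀ hx₀ => ?_
  obtain ⟨p₀, -, rfl⟩ := Finset.mem_image.1 hx₀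
  refine ⟨sepPoly (design576 p₀), totalDegree_sepPoly _, fun x hx => ?_⟩
  obtain ⟨p, -, rfl⟩ := Finset.mem_image.1 hx
  have hev : MvPolynomial.eval (fun ij : Fin 3 × Fin 3 =>
      ((toGL (design576 p) : Matrix.GeneralLinearGroup (Fin 3) ℂ) : Matrix (Fin 3) (Fin 3) ℂ) ij.1 ij.2)
        (sepPoly (design576 p₀)) = ((sepVal (ip (design576 p₀) (design576 p)) : ℝ) : ℂ) := by
    rw [val_toGL (design576_good p).2]
    exact eval_sepPoly _ _
  refine ⟨fun hxx => ?_, fun hxx => ?_⟩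
  · have hpp : p = p₀ := hinj hxx
    subst hpp
    rw [hev, (design576_good p).1, sepVal_four]
    simpa using (by linarith : (0 : ℝ) ≤ η)
  · have hpp : design576 p₀ ≠ design576 p := fun h => hxx (by rw [design576_injective h])
    obtain ⟨hlo, hhi⟩ := ip_bounds (design576_good p₀).1 (design576_good p).1 hpp
    rw [hev, Complex.norm_real, Real.norm_eq_abs]
    exact (abs_sepVal_le hlo hhi).trans hη

/-- The conclusion fails at `(n, s, N) = (3, 2, 576, 1, 1)` whatever the value of `ω > 0`:
`576^{ω/3} > 512^{ω/3} = 8^ω = 64·8^{ω-2} > 55·8^{ω-2}`. [folklore] -/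
theorem not_conclusion_576 : ¬ Conclusion 3 2 576 1 1 := by
  unfold Conclusion
  intro h
  set ω := omega ℂ with hω
  have hω2 : (2 : ℝ) ≤ ω := omega_two_le ℂ
  have hωpos : 0 < ω / 3 := by linarith
  have hC : (((2 : ℕ) + 3 ^ 2).choose (3 ^ 2) : ℝ) = 55 := by norm_num [Nat.choose]
  have hexp : ((3 : ℕ) : ℝ) * ((3 : ℕ) - 1) / 2 * (ω - 2) = 3 * (ω - 2) := by push_cast; ring
  have hR : ((2 : ℕ) : ℝ) ^ (((3 : ℕ) : ℝ) * ((3 : ℕ) - 1) / 2 * (ω - 2)) = (8 : ℝ) ^ (ω - 2) := by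
    rw [hexp, Real.rpow_mul (by norm_num : (0 : ℝ) ≤ (2 : ℕ))]
    norm_num
  have hL : (((576 : ℕ) : ℝ) * ((1 : ℕ) : ℝ) * ((1 : ℕ) : ℝ)) = 576 := by norm_num
  rw [hC, hR, hL] at h
  have h512 : (512 : ℝ) ^ (ω / 3) < (576 : ℝ) ^ (ω / 3) :=
    Real.rpow_lt_rpow (by norm_num) (by norm_num) hωpos
  have h8 : (512 : ℝ) ^ (ω / 3) = (8 : ℝ) ^ ω := by
    rw [show (512 : ℝ) = (8 : ℝ) ^ (3 : ℝ) by norm_num, ← Real.rpow_mul (by norm_num)]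
    ring_nf
  have hsplit : (8 : ℝ) ^ ω = 64 * (8 : ℝ) ^ (ω - 2) := by
    rw [show (64 : ℝ) = (8 : ℝ) ^ (2 : ℝ) by norm_num, ← Real.rpow_add (by norm_num)]
    ring_nf
  have hpos : 0 < (8 : ℝ) ^ (ω - 2) := Real.rpow_pos_of_pos (by norm_num) _
  linarith

/-- The crux asked at ONE tolerance `η` only (a design at tolerance `η` already prices). [folklore] -/
def SeparationDegreeCostFixedTol (η : ℝ) : Prop :=
  ∀ n : ℕ, 3 ≤ n → ∀ s : ℕ, 2 ≤ s → ∀ N₁ N₂ N₃ : ℕ, DesignAt n s N₁ N₂ N₃ η → Conclusion n s N₁ N₂ N₃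

/-- The fixed-tolerance variant is a STRENGTHENING of the crux (for any `η > 0`). [folklore] -/
theorem separationDegreeCost_of_fixedTol {η : ℝ} (hη : 0 < η) (h : SeparationDegreeCostFixedTol η) :
    SeparationDegreeCost :=
  fun n hn s hs N₁ N₂ N₃ hd => h n hn s hs N₁ N₂ N₃ (hd η hη)

/-- **Load-bearing: the limit `η → 0`.**  No single tolerance `η ≥ 3/7` prices designs: the
fixed-tolerance strengthening of `SeparationDegreeCost` is false (`designAt_576`,
`not_conclusion_576`).  Any proof of the crux must use designs at arbitrarily small `η`. [folklore] -/
theorem separationDegreeCost_fixedTol_false {η : ℝ} (hη : 3 / 7 ≤ η) :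
    ¬ SeparationDegreeCostFixedTol η :=
  fun h => not_conclusion_576 (h 3 le_rfl 2 le_rfl 576 1 1 (designAt_576 hη))

end SeparationDegreeCostNeg

end Summit.MatrixMultiplication.MatrixMultiplication.Theorems
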